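import Mathlib.Analysis.InnerProductSpace.PiL2
import Literature.Computability.QuantumComplexity.QueryHybridBound
import HarnessLib

/-!
# The run of a query algorithm against a time-dependent oracle (BBBV Theorem 3.3, general form)

Bennett–Bernstein–Brassard–Vazirani, *Strengths and weaknesses of quantum computing*, SIAM J.
Comput. 26 (1997), Theorem 3.3 (arXiv:quant-ph/9701001, pp. 7–8) compares the run `|φ_i⟩` of a
query machine with a fixed oracle to the run `|φ'_i⟩` in which "the answer to each query
`(i, y) ∈ F` is modified to some arbitrary fixed `a_{i,y}` (these answers need not be consistent
with an oracle)" — i.e. to a run against a TIME-DEPENDENT oracle `A_i`, round `i` being answered by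
`A_i` — and proves `‖φ_T − φ'_T‖ ≤ ∑_{i<T} ‖E_i‖`, `|E_i⟩ = U_i|φ_i⟩ − U|φ_i⟩` the error of the
`i`-th step, by unitarity and telescoping.

`QueryHybridBound.lean` formalises the special case of two FIXED oracles (`stateAt`,
`l2Norm'_stateAt_sub_le_sum`). This sequel formalises the printed generality for the tree's query
model `QQueryAlg` (`QuantumQuery.lean`): a SCHEDULE `x : ℕ → (Fin N → Bool)` answers query round
`r` (0-based) with the input `x r`, and

* `stateAtSched A x s` is the state after `s` rounds (`stateAtSched_const`: a constant schedule
  gives `stateAt`; `stateAtSched_congr`: the state after `s` rounds depends only on `x 0, …, x (s-1)`;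
  `l2Norm'_stateAtSched`: unit vectors);
* `l2Norm'_stateAtSched_sub_le_sum` — THE HYBRID BOUND for two schedules `x, y`:
  `‖ψ_T^x − ψ_T^y‖ ≤ ∑_{t<T} ‖(O_{x t} − O_{y t}) ψ_t^x‖` (proof verbatim that of
  `l2Norm'_stateAt_sub_le_sum`);
* `l2Norm'_stateAtSched_sub_le_sum_sqrt_queryMagnitude`, `…_le_of_sum_queryMagnitude_le` — Theorem
  3.3 as printed, for modifications given by blocks `F t` of flipped bits at round `t`
  (`y t = flipBlock (x t) (F t)`): `‖ψ_T^x − ψ_T^y‖ ≤ ∑_{t<T} 2√(m_{F t}(ψ_t^x))`, hence `≤ 2ε` when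
  `∑_{t<T} m_{F t}(ψ_t^x) ≤ ε²/T`. CONSTANT: the printed conclusion is `≤ ε`; the printed proof
  bounds `‖E_i‖²` by the modified query magnitude, whereas for the bit-flip oracle
  `|i, b, z⟩ ↦ |i, b ⊕ x_i, z⟩` of the tree's model one modified query costs exactly
  `‖(O_x − O_{x^B})ψ‖² ≤ 4·m_B(ψ)` (`sum_norm_sq_oracle_sub_le`; equality at `ψ = (|i,0⟩ − |i,1⟩)/√2`),
  so the constant obtained — and the sharp one for this model — is `2ε`;
* `abs_sum_norm_sq_sub_le`, `abs_sum_norm_sq_sub_le_two_mul`, `abs_acceptWeight_sub_le` — the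
  measurement step for ARBITRARY (unit) vectors: the weights of any set `S` of basis states under
  `ψ` and `ψ'` differ by at most `(‖ψ‖ + ‖ψ'‖)·‖ψ − ψ'‖ ≤ 2‖ψ − ψ'‖` (the weak, one-event form of
  BBBV Thm. 3.1 used in `abs_acceptProb_sub_le`, with `finalState` replaced by any unit vectors);
  `acceptProb_eq_sum_stateAtSched` links back to `QQueryAlg.acceptProb`.

All statements are over the vocabulary of `QueryHybridBound.lean` (`l2Norm'`, `unitaryAt`,
`stateAt`, `queryMagnitude`) and `QuantumQuery.lean` (`QQueryAlg`, `queryOracle`); nothing there is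
restated. Requested (same short names) by the moving-horizon / truncation hybrids of
`Summits/QuantumAdvantage` (welded-tree sink problem), where the reference run itself queries a
round-dependent input.

## References

* C. H. Bennett, E. Bernstein, G. Brassard, U. Vazirani, *Strengths and weaknesses of quantum
  computing*, SIAM J. Comput. 26 (1997) 1510–1523, Thm. 3.1, Def. 3.2, Thm. 3.3 (arXiv:quant-ph/9701001,
  pp. 7–8) [BennettBernsteinBrassardVazirani1997].
* R. Beals, H. Buhrman, R. Cleve, M. Mosca, R. de Wolf, *Quantum lower bounds by polynomials*,
  J. ACM 48 (2001) 778–797, §3 (the model) [BealsEtAl2001].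
-/

namespace Literature.Computability.QuantumComplexity

open Matrix Finset Literature.Computability.Cryptography Literature.Computability.Complexity

/-! ### Two more facts about the `ℓ²`-norm -/

section L2

variable {ι : Type*} [Fintype ι]

/-- `‖a − b‖₂ = ‖b − a‖₂`. [folklore] -/
theorem l2Norm'_sub_rev (a b : ι → ℂ) : l2Norm' (a - b) = l2Norm' (b - a) := by
  simp only [l2Norm', WithLp.toLp_sub]
  exact norm_sub_rev _ _

/-- **Weights of nearby vectors.** For any set `S` of basis states,
`|∑_{s∈S} |a_s|² − ∑_{s∈S} |b_s|²| ≤ (‖a‖₂ + ‖b‖₂)·‖a − b‖₂` (pointwise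
`||a_s|² − |b_s|²| ≤ |a_s − b_s|(|a_s| + |b_s|)`, then Cauchy–Schwarz and Minkowski); for unit vectors
this is the one-event form of BBBV Thm. 3.1 (`abs_sum_norm_sq_sub_le_two_mul`). [folklore] -/
theorem abs_sum_norm_sq_sub_le (S : Finset ι) (a b : ι → ℂ) :
    |∑ s ∈ S, ‖a s‖ ^ 2 - ∑ s ∈ S, ‖b s‖ ^ 2| ≤ (l2Norm' a + l2Norm' b) * l2Norm' (a - b) := by
  have hpt : ∀ s, |‖a s‖ ^ 2 - ‖b s‖ ^ 2| ≤ ‖(a - b) s‖ * (‖a s‖ + ‖b s‖) := by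
    intro s
    rw [sq_sub_sq, abs_mul, abs_of_nonneg (by positivity), mul_comm, Pi.sub_apply]
    exact mul_le_mul_of_nonneg_right (abs_norm_sub_norm_le _ _) (by positivity)
  -- Minkowski for the real vectors `(|a_s|)_s`, `(|b_s|)_s`, via Cauchy–Schwarz
  have hmink : Real.sqrt (∑ s, (‖a s‖ + ‖b s‖) ^ 2) ≤ l2Norm' a + l2Norm' b := by
    rw [l2Norm'_eq_sqrt, l2Norm'_eq_sqrt]
    set A := Real.sqrt (∑ s, ‖a s‖ ^ 2) with hA
    set B := Real.sqrt (∑ s, ‖b s‖ ^ 2) with hB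
    have hA0 : 0 ≤ A := Real.sqrt_nonneg _
    have hB0 : 0 ≤ B := Real.sqrt_nonneg _
    have hcs : ∑ s, ‖a s‖ * ‖b s‖ ≤ A * B := Real.sum_mul_le_sqrt_mul_sqrt _ _ _
    have hA2 : A ^ 2 = ∑ s, ‖a s‖ ^ 2 := Real.sq_sqrt (Finset.sum_nonneg fun s _ => by positivity)
    have hB2 : B ^ 2 = ∑ s, ‖b s‖ ^ 2 := Real.sq_sqrt (Finset.sum_nonneg fun s _ => by positivity)
    have hexp : ∑ s, (‖a s‖ + ‖b s‖) ^ 2 =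
        ∑ s, ‖a s‖ ^ 2 + 2 * ∑ s, ‖a s‖ * ‖b s‖ + ∑ s, ‖b s‖ ^ 2 := by
      rw [Finset.mul_sum, ← Finset.sum_add_distrib, ← Finset.sum_add_distrib]
      exact Finset.sum_congr rfl fun s _ => by ring
    calc Real.sqrt (∑ s, (‖a s‖ + ‖b s‖) ^ 2) ≤ Real.sqrt ((A + B) ^ 2) :=
          Real.sqrt_le_sqrt (by rw [hexp, add_sq, hA2, hB2]; nlinarith [hcs])
      _ = A + B := Real.sqrt_sq (by positivity)
  rw [← Finset.sum_sub_distrib]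
  calc |∑ s ∈ S, (‖a s‖ ^ 2 - ‖b s‖ ^ 2)|
      ≤ ∑ s ∈ S, |‖a s‖ ^ 2 - ‖b s‖ ^ 2| := Finset.abs_sum_le_sum_abs _ _
    _ ≤ ∑ s, |‖a s‖ ^ 2 - ‖b s‖ ^ 2| :=
        Finset.sum_le_univ_sum_of_nonneg fun s => abs_nonneg _
    _ ≤ ∑ s, ‖(a - b) s‖ * (‖a s‖ + ‖b s‖) := Finset.sum_le_sum fun s _ => hpt s
    _ ≤ Real.sqrt (∑ s, ‖(a - b) s‖ ^ 2) * Real.sqrt (∑ s, (‖a s‖ + ‖b s‖) ^ 2) :=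
        Real.sum_mul_le_sqrt_mul_sqrt _ _ _
    _ ≤ l2Norm' (a - b) * (l2Norm' a + l2Norm' b) := by
        rw [← l2Norm'_eq_sqrt]
        exact mul_le_mul_of_nonneg_left hmink (l2Norm'_nonneg _)
    _ = (l2Norm' a + l2Norm' b) * l2Norm' (a - b) := mul_comm _ _

/-- **Weights of nearby unit vectors**: `|∑_{s∈S} |a_s|² − ∑_{s∈S} |b_s|²| ≤ 2‖a − b‖₂` for unit
vectors `a, b` and any set `S` of basis states (the one-event form of BBBV Thm. 3.1; cf.
`abs_acceptProb_sub_le`, the case of two final states). [cite: BennettBernsteinBrassardVazirani1997, Thm 3.1] -/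
theorem abs_sum_norm_sq_sub_le_two_mul (S : Finset ι) {a b : ι → ℂ} (ha : l2Norm' a = 1)
    (hb : l2Norm' b = 1) :
    |∑ s ∈ S, ‖a s‖ ^ 2 - ∑ s ∈ S, ‖b s‖ ^ 2| ≤ 2 * l2Norm' (a - b) := by
  have h := abs_sum_norm_sq_sub_le S a b
  rw [ha, hb] at h
  linarith

end L2

/-! ### The run against a schedule of inputs -/

variable {N : ℕ}

/-- The state of `A` after `s` query rounds when round `r` (0-based) queries the input `x r`:
`ψ_0 = U_0 |start⟩`, `ψ_{s+1} = U_{s+1} O_{x s} ψ_s` — the run against a TIME-DEPENDENT oracle, BBBV's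
`|φ'_i⟩` ("the answer to each query `(i, y) ∈ F` is modified"). With the constant schedule this is
`stateAt` (`stateAtSched_const`). [cite: BennettBernsteinBrassardVazirani1997, Thm 3.3] -/
noncomputable def stateAtSched (A : QQueryAlg N) (x : ℕ → (Fin N → Bool)) :
    ℕ → (Fin N × Bool × A.W → ℂ)
  | 0 => unitaryAt A 0 *ᵥ Pi.single A.start 1
  | s + 1 => unitaryAt A (s + 1) *ᵥ (queryOracle (x s) *ᵥ stateAtSched A x s)

/-- Round `0`: `ψ_0 = U_0 |start⟩` (no query yet). [cite: BennettBernsteinBrassardVazirani1997, Thm 3.3] -/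
@[simp]
theorem stateAtSched_zero (A : QQueryAlg N) (x : ℕ → (Fin N → Bool)) :
    stateAtSched A x 0 = unitaryAt A 0 *ᵥ Pi.single A.start 1 := rfl

/-- Round `s + 1`: `ψ_{s+1} = U_{s+1} O_{x s} ψ_s`. [cite: BennettBernsteinBrassardVazirani1997, Thm 3.3] -/
theorem stateAtSched_succ (A : QQueryAlg N) (x : ℕ → (Fin N → Bool)) (s : ℕ) :
    stateAtSched A x (s + 1) = unitaryAt A (s + 1) *ᵥ (queryOracle (x s) *ᵥ stateAtSched A x s) :=
  rfl

/-- With a constant schedule the time-dependent run is the ordinary run `stateAt`.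
[cite: BennettBernsteinBrassardVazirani1997, Thm 3.3] -/
theorem stateAtSched_const (A : QQueryAlg N) (x : Fin N → Bool) (s : ℕ) :
    stateAtSched A (fun _ => x) s = stateAt A x s := by
  induction s with
  | zero => rfl
  | succ s ih => simp only [stateAtSched, stateAt, ih]

/-- The state after `s` rounds depends only on the inputs queried in rounds `< s`. [folklore] -/
theorem stateAtSched_congr (A : QQueryAlg N) {x y : ℕ → (Fin N → Bool)} {s : ℕ}
    (h : ∀ r < s, x r = y r) : stateAtSched A x s = stateAtSched A y s := by
  induction s with
  | zero => rfl
  | succ s ih =>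
    rw [stateAtSched_succ, stateAtSched_succ, h s (Nat.lt_succ_self s),
      ih fun r hr => h r (Nat.lt_succ_of_lt hr)]

/-- Every `ψ_s` is a unit vector (all `U_k` and `O_x` are unitary). [cite: BealsEtAl2001, §3] -/
theorem l2Norm'_stateAtSched (A : QQueryAlg N) (x : ℕ → (Fin N → Bool)) (s : ℕ) :
    l2Norm' (stateAtSched A x s) = 1 := by
  induction s with
  | zero => rw [show stateAtSched A x 0 = stateAt A (x 0) 0 from rfl, l2Norm'_stateAt]
  | succ s ih =>
    rw [stateAtSched_succ, l2Norm'_mulVec_of_mem_unitaryGroup (unitaryAt_mem A (s + 1)),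
      l2Norm'_mulVec_of_mem_unitaryGroup (queryOracle_mem_unitaryGroup (x s)), ih]

/-- `∑_b |ψ_s(b)|² = 1`. [cite: BealsEtAl2001, §3] -/
theorem sum_norm_sq_stateAtSched (A : QQueryAlg N) (x : ℕ → (Fin N → Bool)) (s : ℕ) :
    ∑ b, ‖stateAtSched A x s b‖ ^ 2 = 1 := by
  rw [← l2Norm'_sq, l2Norm'_stateAtSched, one_pow]

/-! ### The hybrid argument for two schedules -/

/-- One round: `‖ψ_{t+1}^x − ψ_{t+1}^y‖ ≤ ‖(O_{x t} − O_{y t}) ψ_t^x‖ + ‖ψ_t^x − ψ_t^y‖` (the same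
`U_{t+1}` acts on both runs; `O_{y t}` is unitary). [cite: BennettBernsteinBrassardVazirani1997,
Thm 3.3 (proof)] -/
theorem l2Norm'_stateAtSched_succ_sub_le (A : QQueryAlg N) (x y : ℕ → (Fin N → Bool)) (t : ℕ) :
    l2Norm' (stateAtSched A x (t + 1) - stateAtSched A y (t + 1)) ≤
      l2Norm' (queryOracle (x t) *ᵥ stateAtSched A x t - queryOracle (y t) *ᵥ stateAtSched A x t) +
        l2Norm' (stateAtSched A x t - stateAtSched A y t) := by
  rw [stateAtSched_succ, stateAtSched_succ, ← Matrix.mulVec_sub,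
    l2Norm'_mulVec_of_mem_unitaryGroup (unitaryAt_mem A (t + 1))]
  calc l2Norm' (queryOracle (x t) *ᵥ stateAtSched A x t - queryOracle (y t) *ᵥ stateAtSched A y t)
      ≤ l2Norm' (queryOracle (x t) *ᵥ stateAtSched A x t - queryOracle (y t) *ᵥ stateAtSched A x t) +
          l2Norm' (queryOracle (y t) *ᵥ stateAtSched A x t -
            queryOracle (y t) *ᵥ stateAtSched A y t) :=
        l2Norm'_sub_le _ _ _
    _ = _ := by
        rw [← Matrix.mulVec_sub (queryOracle (y t)),
          l2Norm'_mulVec_of_mem_unitaryGroup (queryOracle_mem_unitaryGroup (y t))]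

/-- **The hybrid bound for time-dependent oracles** (BBBV Thm. 3.3, telescoped, both runs
scheduled): `‖ψ_T^x − ψ_T^y‖ ≤ ∑_{t<T} ‖(O_{x t} − O_{y t}) ψ_t^x‖`.
[cite: BennettBernsteinBrassardVazirani1997, Thm 3.3] -/
theorem l2Norm'_stateAtSched_sub_le_sum (A : QQueryAlg N) (x y : ℕ → (Fin N → Bool)) (T : ℕ) :
    l2Norm' (stateAtSched A x T - stateAtSched A y T) ≤
      ∑ t ∈ Finset.range T,
        l2Norm' (queryOracle (x t) *ᵥ stateAtSched A x t - queryOracle (y t) *ᵥ stateAtSched A x t) := by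
  induction T with
  | zero =>
    have : stateAtSched A x 0 = stateAtSched A y 0 := rfl
    rw [this, sub_self, l2Norm'_zero, Finset.sum_range_zero]
  | succ T ih =>
    rw [Finset.sum_range_succ]
    linarith [l2Norm'_stateAtSched_succ_sub_le A x y T]

/-- **Modified queries cost their query magnitude** (BBBV Thm. 3.3, the bound by query magnitudes):
if round `t` of the second run answers with `x t` flipped on the block `F t`, then
`‖ψ_T^x − ψ_T^{x,F}‖ ≤ ∑_{t<T} 2√(m_{F t}(ψ_t^x))`. [cite: BennettBernsteinBrassardVazirani1997, Thm 3.3] -/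
theorem l2Norm'_stateAtSched_sub_le_sum_sqrt_queryMagnitude (A : QQueryAlg N)
    (x : ℕ → (Fin N → Bool)) (F : ℕ → Finset (Fin N)) (T : ℕ) :
    l2Norm' (stateAtSched A x T - stateAtSched A (fun t => flipBlock (x t) (F t)) T) ≤
      ∑ t ∈ Finset.range T, 2 * Real.sqrt (queryMagnitude (F t) (stateAtSched A x t)) :=
  (l2Norm'_stateAtSched_sub_le_sum A x _ T).trans
    (Finset.sum_le_sum fun t _ => l2Norm'_oracle_sub_le (x t) (F t) (stateAtSched A x t))

/-- **BBBV Theorem 3.3** in the tree's query model: if the modified queries have total magnitude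
`∑_{t<T} m_{F t}(ψ_t^x) ≤ ε²/T` along the unmodified run, then `‖ψ_T^x − ψ_T^{x,F}‖ ≤ 2ε` (printed:
`≤ ε`; the factor `2` is the exact one-query cost `‖(O_x − O_{x^B})ψ‖ ≤ 2√(m_B(ψ))` of the bit-flip
oracle, `l2Norm'_oracle_sub_le`, see the module docstring). [cite: BennettBernsteinBrassardVazirani1997, Thm 3.3] -/
theorem l2Norm'_stateAtSched_sub_le_of_sum_queryMagnitude_le (A : QQueryAlg N)
    (x : ℕ → (Fin N → Bool)) (F : ℕ → Finset (Fin N)) {T : ℕ} {ε : ℝ} (hε : 0 ≤ ε)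
    (h : ∑ t ∈ Finset.range T, queryMagnitude (F t) (stateAtSched A x t) ≤ ε ^ 2 / T) :
    l2Norm' (stateAtSched A x T - stateAtSched A (fun t => flipBlock (x t) (F t)) T) ≤ 2 * ε := by
  rcases Nat.eq_zero_or_pos T with rfl | hT
  · have : stateAtSched A x 0 = stateAtSched A (fun t => flipBlock (x t) (F t)) 0 := rfl
    rw [this, sub_self, l2Norm'_zero]
    positivity
  have hTR : (0 : ℝ) < T := by exact_mod_cast hT
  set S := ∑ t ∈ Finset.range T, queryMagnitude (F t) (stateAtSched A x t) with hS
  have hS0 : 0 ≤ S := Finset.sum_nonneg fun t _ => queryMagnitude_nonneg (F t) _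
  have hTS : (T : ℝ) * S ≤ ε ^ 2 := by
    rw [mul_comm]
    exact (le_div_iff₀ hTR).1 h
  -- Cauchy–Schwarz: `∑ √m_t ≤ √T · √(∑ m_t)`
  have hcs := Real.sum_sqrt_mul_sqrt_le (Finset.range T) (f := fun _ => (1 : ℝ))
    (g := fun t => queryMagnitude (F t) (stateAtSched A x t)) (fun _ => zero_le_one)
    (fun t => queryMagnitude_nonneg (F t) _)
  simp only [Real.sqrt_one, one_mul, Finset.sum_const, Finset.card_range, nsmul_eq_mul,
    mul_one] at hcs
  calc l2Norm' (stateAtSched A x T - stateAtSched A (fun t => flipBlock (x t) (F t)) T)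
      ≤ ∑ t ∈ Finset.range T, 2 * Real.sqrt (queryMagnitude (F t) (stateAtSched A x t)) :=
        l2Norm'_stateAtSched_sub_le_sum_sqrt_queryMagnitude A x F T
    _ = 2 * ∑ t ∈ Finset.range T, Real.sqrt (queryMagnitude (F t) (stateAtSched A x t)) := by
        rw [Finset.mul_sum]
    _ ≤ 2 * (Real.sqrt T * Real.sqrt S) := mul_le_mul_of_nonneg_left hcs (by norm_num)
    _ ≤ 2 * ε := by
        refine mul_le_mul_of_nonneg_left ?_ (by norm_num)
        rw [← Real.sqrt_mul (Nat.cast_nonneg T)]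
        calc Real.sqrt (T * S) ≤ Real.sqrt (ε ^ 2) := Real.sqrt_le_sqrt hTS
          _ = ε := Real.sqrt_sq hε

/-! ### Acceptance weights of scheduled runs -/

/-- The acceptance weights of two unit vectors on `A`'s accepting basis states differ by at most
`2‖ψ − ψ'‖₂` (`abs_acceptProb_sub_le` with the final states replaced by arbitrary unit vectors).
[cite: BennettBernsteinBrassardVazirani1997, Thm 3.1] -/
theorem abs_acceptWeight_sub_le (A : QQueryAlg N) [DecidablePred (· ∈ A.accept)]
    {ψ ψ' : Fin N × Bool × A.W → ℂ} (hψ : l2Norm' ψ = 1) (hψ' : l2Norm' ψ' = 1) :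
    |∑ s with s ∈ A.accept, ‖ψ s‖ ^ 2 - ∑ s with s ∈ A.accept, ‖ψ' s‖ ^ 2| ≤
      2 * l2Norm' (ψ - ψ') :=
  abs_sum_norm_sq_sub_le_two_mul _ hψ hψ'

/-- In particular for the states of two scheduled runs after `T` rounds.
[cite: BennettBernsteinBrassardVazirani1997, Thm 3.1] -/
theorem abs_acceptWeight_stateAtSched_sub_le (A : QQueryAlg N) [DecidablePred (· ∈ A.accept)]
    (x y : ℕ → (Fin N → Bool)) (T : ℕ) :
    |∑ s with s ∈ A.accept, ‖stateAtSched A x T s‖ ^ 2 -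
        ∑ s with s ∈ A.accept, ‖stateAtSched A y T s‖ ^ 2| ≤
      2 * l2Norm' (stateAtSched A x T - stateAtSched A y T) :=
  abs_acceptWeight_sub_le A (l2Norm'_stateAtSched A x T) (l2Norm'_stateAtSched A y T)

/-- The acceptance probability of the ordinary run is the acceptance weight of the constant-schedule
run after `T = A.queries` rounds. [cite: BealsEtAl2001, §3] -/
theorem acceptProb_eq_sum_stateAtSched (A : QQueryAlg N) [DecidablePred (· ∈ A.accept)]
    (x : Fin N → Bool) :
    A.acceptProb x = ∑ s with s ∈ A.accept, ‖stateAtSched A (fun _ => x) A.queries s‖ ^ 2 := by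
  unfold QQueryAlg.acceptProb
  rw [finalState_eq_stateAt, stateAtSched_const]
  congr

end Literature.Computability.QuantumComplexity
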